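import Literature.Topology.FourManifolds.BordismFourThomInvariantKernel
import HarnessLib

/-!
# `|𝔑₄| = 4` (Thom 1954, Thm IV.12): decomposition of the named fact along the
# orientable / non-orientable dichotomy (fact-decompose, 2026-08-16)

R. Thom, *Quelques propriétés globales des variétés différentiables*, Comment. Math. Helv. 28
(1954), Thm IV.12 with pp. 79–80 (`𝔑⁴ ≅ ℤ₂ + ℤ₂`, generated by `PC(2)` and `PR(4)`) and
Thm IV.13 (`Ω⁴ ≅ ℤ`, the index). The named fact
`Literature.Topology.FourManifolds.natCard_unorientedBordismClass_four` (`BordismFour.lean`,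
`Nat.card 𝔑₄ = 4`) is PROVED in the tree from two inputs
(`natCard_unorientedBordismClass_four_of_thom_of_exists_orientable`,
`BordismFourThomInvariantKernel.lean` §4): Thom's Thm IV.13 on `Ω⁴` — the existing named fact
`isOrientedBordant_of_signature_eq` (`BordismFourProofs.lean`), which settles the orientable
classes (`BordismFourOrientableClasses.lean`) — and the statement that a closed smooth
4-manifold with `w₁⁴[M] = 0` is bordant mod 2 to an orientable one, written there as a plain
binder (D-0026). The lower bound `4 ≤ |𝔑₄|` (the four pairwise distinct classes
`0, [ℂℙ²], [ℝℙ⁴], [ℂℙ²] + [ℝℙ⁴]`), the additivity of Thom's invariant `(χ mod 2, v₁⁴)` and the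
reduction to the triviality of its kernel are theorems of the tree. The proving seat hit the
budget cap on the Pontryagin–Thom side. This file turns the second input into a named fact and
records the assembly:

* `exists_orientable_unorientedBordant_of_wuNumberOnePowFour_eq_zero` — **child**: every closed
  smooth 4-manifold `M` with `v₁⁴[M] = 0` (`= w₁⁴[M]` by Wu's formula) has the unoriented bordism
  class of some closed smooth 4-manifold carrying a `ℤ`-homological orientation. In the source
  this is read off Thm IV.12 at `k = 4` (the classes with `w₁⁴ = 0` are `0` and `[PC(2)]`, both
  orientable); intrinsically it is the case `n = 4` of Wall's determination of the image of
  `Ω_* → 𝔑_*` (Wall 1960: a class lies in the image iff all its Stiefel–Whitney numbers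
  involving `w₁` vanish; on a closed 4-manifold these are `w₁⁴` and `w₁²w₂ = 0`).
* `natCard_unorientedBordismClass_four_holds_of` — **the assembly**
  `isOrientedBordant_of_signature_eq → (child) → natCard_unorientedBordismClass_four` (proved).

The child speaks about orientability of a bordism class, not about the cardinality of `𝔑₄`; it
is neither weaker nor stronger than the parent in any evident way (no restatement).

## References

* [ThomCMH1954] R. Thom, Comment. Math. Helv. 28 (1954), 17–86: Thm IV.10, Cor. IV.11 (p. 77),
  Thm IV.12 and pp. 79–80, Thm IV.13 (p. 81).
* [Wall1960] C. T. C. Wall, *Determination of the cobordism ring*, Ann. of Math. 72 (1960),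
  292–311 (Introduction and main theorem: the image of `Ω → 𝔑`).
-/

noncomputable section

open scoped Manifold ContDiff
open Literature.AlgebraicTopology.SingularHomology

namespace Literature.Topology.FourManifolds

/-- **A closed smooth 4-manifold with `w₁⁴[M] = 0` is bordant mod 2 to an orientable one**
(named fact; Thom 1954, Thm IV.12 at `k = 4`: "`𝔑⁴ ≅ ℤ₂ + ℤ₂`", the classes with `w₁⁴ = 0`
being `0` and `[PC(2)]`, pp. 79–80; Wall 1960: the image of `Ω_n → 𝔑_n` consists of the classes
all of whose Stiefel–Whitney numbers with a factor `w₁` vanish — for `n = 4` the numbers `w₁⁴`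
and `w₁²w₂`, the latter zero on every closed 4-manifold). Statement (the hypothesis `hW` of
`natCard_unorientedBordismClass_four_of_thom_of_exists_orientable`, verbatim; universe `0`): for
every compact boundaryless smooth 4-manifold `M` (Hausdorff, charted on `ℝ⁴`) with Wu number
`v₁⁴[M] = wuNumberOnePowFour M = 0` (`BordismWuNumbers.lean`; `v₁ = w₁` by Wu's formula) there is
a compact smooth 4-manifold `N` (Hausdorff, second countable) with a `ℤ`-homological orientation
`HomologicalOrientation ℤ N 4` and `[M] = [N]` in `UnorientedBordismClass 4`.
[cite: ThomCMH1954, Thm IV.12 and pp. 79–80] [cite: Wall1960, Introduction (image of Ω → 𝔑)] -/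
def exists_orientable_unorientedBordant_of_wuNumberOnePowFour_eq_zero : Prop :=
  ∀ (M : Type) [TopologicalSpace M] [T2Space M] [ChartedSpace (EuclideanSpace ℝ (Fin 4)) M]
    [IsManifold (𝓡 4) ∞ M] [CompactSpace M] [BoundarylessManifold (𝓡 4) M],
    wuNumberOnePowFour M = 0 →
      ∃ (N : Type) (_ : TopologicalSpace N) (_ : T2Space N) (_ : SecondCountableTopology N)
        (_ : ChartedSpace (EuclideanSpace ℝ (Fin 4)) N) (_ : CompactSpace N)
        (_ : IsManifold (𝓡 4) ∞ N) (_ : HomologicalOrientation ℤ N 4),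
        (UnorientedBordismClass.mk M : UnorientedBordismClass.{0} 4) = UnorientedBordismClass.mk N

/-- **Assembly of `|𝔑₄| = 4` (Thom 1954, Thm IV.12)**: the named fact
`natCard_unorientedBordismClass_four` follows from Thom's Thm IV.13 on `Ω⁴`
(`isOrientedBordant_of_signature_eq`, existing named fact) and the child
`exists_orientable_unorientedBordant_of_wuNumberOnePowFour_eq_zero` — the tree's theorem
`natCard_unorientedBordismClass_four_of_thom_of_exists_orientable` (an orientable class with
`χ` even is `0`; Thom's invariant is additive with trivial kernel; four distinct classes exist).
The discharge `natCard_unorientedBordismClass_four_holds` is this theorem applied to the two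
`…_holds` once they land. [cite: ThomCMH1954, Thm IV.12 (pp. 79–80) and Thm IV.13 (p. 81)] -/
theorem natCard_unorientedBordismClass_four_holds_of (hX : isOrientedBordant_of_signature_eq.{0})
    (hW : exists_orientable_unorientedBordant_of_wuNumberOnePowFour_eq_zero) :
    natCard_unorientedBordismClass_four :=
  natCard_unorientedBordismClass_four_of_thom_of_exists_orientable hX hW

end Literature.Topology.FourManifolds

end
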